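import Mathlib.Analysis.Calculus.Gradient.Basic
import Mathlib.Analysis.Calculus.LocalExtr.Basic
import Literature.MathematicalPhysics.QuantumFieldTheory.Balaban1983to89.T3DescentSection
import Literature.MathematicalPhysics.QuantumFieldTheory.Balaban1983to89.T3PrintedRegularMinimiser
import Summits.QuantumFields.YangMills.Theorems.UnitScaleTiltFluctuationComparisonRegPrGlobalSlackKernelLegCfgFixedPointFine
import HarnessLib

/-!
# `UnitScaleTiltFluctuationComparisonRegPrGlobalSlackKernelLegCfgVariational` — THE VARIATIONAL FORM OF THE p12 INPUT: the two-cut-off comparison of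
# constrained minimisers is (i) EXACTLY a comparison of the minimisers of two functionals over ONE fibre (argmin composition) and (ii) controlled by
# ONE first-variation defect (perturbed constrained critical points) (crux `FluctuationComparisonRegPrIntL`, stmt-QuantumFields-20520, skeletons
# v5kC / v5kD, STUB 3⁗χ `stub_globalTwoRunSlackFamChi`; cell `pub/ym-inputs`, seat ym-inputs-p12 = INPUT-LIST I-11 row `CfgDistCauchyΦ`; count-neutral helper,
# def-free, registry untouched)

WHERE THIS SITS.  The seat's files `…KernelLegCfgFixedPoint{,Chi,TwoRun,Fine,Witness}` reduced the I-11 row `CfgDistCauchyΦ` / (R5) `CfgRefOwnΦ` to ONE located-unprinted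
input: in fixed-point language the two-cut-off DEFECT (D)/(M) of [Balaban1985Variational]'s successive-approximation map, in the fine-level language of
`cfgDistCauchyΦ_of_fineComparison` the hypothesis (Fine) «`δ(U_K, Ū_{K+1}) ≤ C_f·θ(n)·(L^{−(K−n)})^a`» — run `K`'s constrained minimiser against the ONCE-AVERAGED
run-`(K+1)` constrained minimiser, both fine configurations of run `K`.  This file says WHAT THAT COMPARISON IS, variationally, with every object free:

* §1 **ARGMIN COMPOSITION (exact).**  Generic: for `π : α → β`, a constraint set `S′ ⊆ α` and a functional `A`, if `u` minimises `A` on `S′` then `π u` minimises the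
  FIBREWISE INFIMUM `w ↦ inf {A x : x ∈ S′, π x = w}` on `π″S′`, and that infimum at `π u` equals `A u` (`isMinOn_fibreInf_image_of_isMinOn`, `fibreInf_apply_eq_of_isMinOn`).
  At the tree's objects (`T3ConstrainedMinimiser.fibre` / `minAction`, `T3TiltDescent.descendTo`, `T3DescentFibreTower`): if `U′` minimises the Wilson action over the
  `(n,K′)`-fibre of `V`, then its `(K′−K)`-fold average `descendTo K K′ U′` lies in the `(n,K)`-fibre of `V` and MINIMISES THE ONE-STEP CLASSICAL EFFECTIVE ACTION
  `minAction F ℰ K K′` over it (`isMinOn_minAction_descendTo_of_isMinOn`, surjectivity `hne` as in `minAction_tower`; over the image without it; HYPOTHESIS-FREE at the printed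
  smearing `ℰp`, `isMinOn_minAction_descendTo_of_isMinOn_ℰp`, by `T3DescentSection.fibre_nonempty_ℰp`), with
  `minAction K K′ (descendTo U′) = wilsonAction4 U′`; the same verbatim over print's regular fibre `regFibrePr` (`isMinOn_fibreInf_descendTo_regFibrePr`).  So run `K`'s
  minimiser `U_K(V)` and the averaged run-`(K+1)` minimiser `Ū_{K+1}(V)` are the constrained minimisers, OVER THE SAME FIBRE, of `A_K` and of `A¹_{K+1} := minAction K (K+1)`
  ([Balaban1985UV3] (41)–(42) p.266: the variational problems nest; the tree had the VALUE identity `minAction_tower`, not the argmin statement).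
* §2 **PERTURBED CONSTRAINED CRITICAL POINTS (generic, real inner-product space).**  ★`mul_norm_sq_le_of_inner` / `norm_sub_le_div_of_inner`: if `⟪∇f̃ w, w − u⟫ = 0` (`w` is
  critical along the direction `w − u`), `m‖w − u‖² ≤ ⟪∇f̃ w − ∇f̃ u, w − u⟫` (strong monotonicity of the gradient between the pair) and `|⟪∇f̃ u, w − u⟫| ≤ Λ‖w − u‖` (`u` is a
  `Λ`-APPROXIMATE critical point along that direction), then `‖w − u‖ ≤ Λ/m`.  Corollaries: the slice forms with a submodule `N ∋ w − u` of admissible directions; the DEFECT form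
  with a second functional `g̃` for which `u` is exactly critical (`|⟪∇f̃ u − ∇g̃ u, h⟫| ≤ Λ‖h‖` on `N`); UNIQUENESS (`Λ = 0`: two slice-critical points of one strongly monotone
  functional coincide — what answers finding F-g4-1 for a configuration family PINNED variationally rather than by `Classical.choice`); FERMAT ON A SLICE
  (`inner_gradient_eq_zero_of_isLocalMin_line`, `…_of_isMinOn`: `HasGradientAt` + a local minimum along `t ↦ w + t•h` ⟹ `⟪∇f̃ w, h⟫ = 0`, Mathlib's `IsLocalMin.hasDerivAt_eq_zero`);
  and the METRIC variant `le_div_of_quadraticGrowth` (quadratic growth of `g` at its minimiser + a Lipschitz bound on the defect `f − g` ⟹ `d ≤ λ/m`), recorded with its located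
  caveat: for the raw difference of two lattice quadratic forms the slice-Lipschitz constant of `f − g` is `O(1)` while `m` is a Poincaré constant `~ L^{−2k}`, so only the
  first-variation form §2 is the usable one ([King1986] Prop. 3.9 (3.73): «a difference of propagators on one line»).
* §3 **THE ROW** ★`cfgDistCauchyΦ_of_variational` = `cfgDistCauchyΦ_of_fineComparison` with (Fine) REPLACED by §2's displays at a free chart `coord K k : S K → E K k` into real
  inner-product spaces (`δ := ‖coord · − coord ·‖`): for every window datum, vectors `a = ∇f̃(w)`, `b = ∇f̃(u)` at `u = coord(U_K)`, `w = coord(Ū_{K+1})` with (Crit) `⟪a, w−u⟫ = 0`,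
  (Mono) `m‖w−u‖² ≤ ⟪a−b, w−u⟫`, `m > 0`, (Grad) `|⟪b, w−u⟫| ≤ Λ‖w−u‖` and (Rate) `Λ ≤ m·C_f·θ(n)·(L^{−(K−n)})^a`.  READING: (Grad)+(Rate) = «run `K`'s constrained minimiser is an
  APPROXIMATE CRITICAL POINT, along the constraint/gauge slice, of run `(K+1)`'s ONE-STEP classical effective action `A¹_{K+1}` in the chart, with residual `m`×budget» — a
  SINGLE-LATTICE, ONE-BLOCK-SPIN-STEP statement; (Mono) is [Balaban1985Variational] (53)–(54) p.286 / [Balaban1985BackgroundPropagators] Thm 3.11 positivity in integrated form; (Crit) is the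
  Euler–Lagrange equation of `Ū_{K+1}` for `A¹_{K+1}` (§1 + §2's Fermat lemma, given differentiability of `A¹_{K+1}∘chart`, [Balaban1985Variational] §G analyticity).
HONEST FRAMING.  Order theory + folklore Hilbert-space algebra + bookkeeping.  It RELOCATES the seat's located-unprinted input (cross-run closeness (M) of two maps along `matchBond`)
to (Grad); (Grad) itself is NOT in print for the non-abelian d = 3 model ([King1986] Prop. 3.9 p.665 is its flat U(1) instance, where `A¹ − A` is a difference of quadratic forms);
no configuration family is defined and no row of 3⁗χ is discharged; nothing of [Balaban1985UV3] / [Balaban1985Variational] / [King1986] is asserted; no summit / rung / gap claim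
(YM₃ on T³ is ladder rung R3, not the Clay problem).

References: T. Bałaban, CMP 102 (1985) 255–275 [Balaban1985UV3] ((41)–(44) pp.266–267); CMP 102 (1985) 277–309 [Balaban1985Variational] (Thm 1 (8) p.279, (15)–(21) pp.280–281,
Prop. 2 p.281, (50)–(54) pp.285–286); C. King, CMP 102 (1986) 649–677 [King1986] (Prop. 3.8 (3.71) p.664, Prop. 3.9 (3.73)–(3.74) p.665); CMP 109 (1987) 249–301 [Balaban1987RG1]
((0.11) p.253); CMP 99 (1985) 389–434 [Balaban1985BackgroundPropagators] (Thm 3.11 p.416).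
-/

set_option autoImplicit false

noncomputable section

open scoped RealInnerProductSpace
open Set Filter Topology InnerProductSpace
open Literature.MathematicalPhysics.QuantumFieldTheory.Balaban1983to89
open Literature.MathematicalPhysics.QuantumFieldTheory.Balaban1983to89.T3ContinuumYM3Torus
open Literature.MathematicalPhysics.QuantumFieldTheory.Balaban1983to89.T3UnitScaleTilt
open Literature.MathematicalPhysics.QuantumFieldTheory.Balaban1983to89.T3LevelShift
open Literature.MathematicalPhysics.QuantumFieldTheory.Balaban1983to89.T3UnitLawDensityEML (ℰp)
open Literature.MathematicalPhysics.QuantumFieldTheory.Balaban1983to89.T3TiltDescent (descendTo)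
open Literature.MathematicalPhysics.QuantumFieldTheory.Balaban1983to89.T3ConstrainedMinimiser (fibre minAction minAction_le minAction_descendTo_le)
open Literature.MathematicalPhysics.QuantumFieldTheory.Balaban1983to89.T3DescentFibreTower (mem_fibre_iff mem_fibre_trans descendTo_mem_fibre)
open Literature.MathematicalPhysics.QuantumFieldTheory.Balaban1983to89.T3DescentSection (fibre_nonempty_ℰp)
open Literature.MathematicalPhysics.QuantumFieldTheory.Balaban1983to89.T3PrintedRegularMinimiser (regFibrePr)
open Literature.MathematicalPhysics.QuantumFieldTheory.Balaban1983to89.T3AlphaInputsAC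
open Literature.MathematicalPhysics.QuantumFieldTheory.Balaban1983to89.T3AlphaPolymerSocket
open Literature.MathematicalPhysics.QuantumFieldTheory.Balaban1983to89.T3AlphaInputsACTwoRun
open Literature.MathematicalPhysics.QuantumFieldTheory.Balaban1983to89.T3AlphaInputsACTwoRunLevel
open Literature.MathematicalPhysics.QuantumFieldTheory.Balaban1985CMP102
open Literature.MathematicalPhysics.QuantumFieldTheory.Balaban1985CMP102.Setting
open Summit.QuantumFields.YangMills.Theorems
open Summit.QuantumFields.YangMills.Theorems.GlobalSlackKernelMatching

namespace Summit.QuantumFields.YangMills.Theorems.GlobalSlackKernelLeg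

/-! ## §1 Argmin composition: the image of a constrained minimiser minimises the fibrewise infimum -/

section Argmin

variable {α β : Type*} (π : α → β) (S' : Set α) (A : α → ℝ)

/-- **THE FIBREWISE INFIMUM AT THE IMAGE OF A MINIMISER IS ITS VALUE**: if `u ∈ S′` minimises `A` on `S′` (values bounded below on `S′`), then
`inf {A x : x ∈ S′, π x = π u} = A u`. [cite: Balaban1985UV3, (41)-(42) p.266] -/
theorem fibreInf_apply_eq_of_isMinOn {u : α} (hu : u ∈ S') (hmin : IsMinOn A S' u) (hbdd : BddBelow (A '' S')) :
    sInf (A '' (S' ∩ π ⁻¹' {π u})) = A u := by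
  refine le_antisymm (csInf_le (hbdd.mono (image_mono inter_subset_left)) ⟨u, ⟨hu, rfl⟩, rfl⟩) ?_
  exact le_csInf ⟨A u, u, ⟨hu, rfl⟩, rfl⟩ (by rintro _ ⟨x, ⟨hx, -⟩, rfl⟩; exact hmin hx)

/-- **ARGMIN COMPOSITION** (exact order theory): if `u ∈ S′` minimises `A` on the constraint set `S′`, then `π u` minimises the ONE-STEP functional
`w ↦ inf {A x : x ∈ S′, π x = w}` on the image `π″S′` (every fibre over the image is nonempty, so no boundedness is needed on that side). [cite: Balaban1985UV3, (41)-(42) p.266] -/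
theorem isMinOn_fibreInf_image_of_isMinOn {u : α} (hu : u ∈ S') (hmin : IsMinOn A S' u) (hbdd : BddBelow (A '' S')) :
    IsMinOn (fun w => sInf (A '' (S' ∩ π ⁻¹' {w}))) (π '' S') (π u) := by
  intro w hw
  obtain ⟨x, hx, rfl⟩ := hw
  show sInf (A '' (S' ∩ π ⁻¹' {π u})) ≤ sInf (A '' (S' ∩ π ⁻¹' {π x}))
  rw [fibreInf_apply_eq_of_isMinOn π S' A hu hmin hbdd]
  exact le_csInf ⟨A x, x, ⟨hx, rfl⟩, rfl⟩ (by rintro _ ⟨y, ⟨hy, -⟩, rfl⟩; exact hmin hy)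

/-- **ARGMIN COMPOSITION OVER ANY BASE SET WITH NONEMPTY FIBRES**: as `isMinOn_fibreInf_image_of_isMinOn`, the conclusion over any `S ⊆ β` all of whose points have a
nonempty `S′`-fibre (e.g. the whole base under surjectivity). [cite: Balaban1985UV3, (41)-(42) p.266] -/
theorem isMinOn_fibreInf_of_isMinOn {u : α} (hu : u ∈ S') (hmin : IsMinOn A S' u) (hbdd : BddBelow (A '' S')) (S : Set β)
    (hne : ∀ w ∈ S, (S' ∩ π ⁻¹' {w}).Nonempty) :
    IsMinOn (fun w => sInf (A '' (S' ∩ π ⁻¹' {w}))) S (π u) := by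
  intro w hw
  obtain ⟨x, hx, hxw⟩ := hne w hw
  have hx' : w ∈ π '' S' := ⟨x, hx, hxw⟩
  exact isMinOn_fibreInf_image_of_isMinOn π S' A hu hmin hbdd hx'

end Argmin

/-! ## §1′ Argmin composition at the tree's fibres: the averaged minimiser minimises the one-step classical effective action -/

section T3

variable (F : T3Family) {G : Type*} [GaugeGroup G] (ℰ : LoopAverage G)

/-- **THE CONSTRAINED MINIMAL ACTION IS ATTAINED AT A MINIMISER** (bookkeeping: `minAction_{n,K}(V) = A(U)` for `U` minimising the Wilson action over the
`(n,K)`-fibre of `V`). [cite: Balaban1985UV3, (41) p.266] -/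
theorem minAction_eq_of_isMinOn {n K : ℕ} (h : n ≤ K) {V : GaugeField (F.P n) 0 G} {U : GaugeField (F.P K) 0 G}
    (hU : U ∈ fibre F ℰ n K h V) (hmin : IsMinOn (fun U => wilsonAction4 U) (fibre F ℰ n K h V) U) :
    minAction F ℰ n K h V = wilsonAction4 U := by
  refine le_antisymm (minAction_le F ℰ hU) ?_
  unfold minAction
  exact le_csInf ⟨_, U, hU, rfl⟩ (by rintro _ ⟨U'', hU'', rfl⟩; exact hmin hU'')

/-- **THE ONE-STEP CLASSICAL EFFECTIVE ACTION AT THE AVERAGED MINIMISER IS THE MINIMAL ACTION**: if `U′` minimises the Wilson action over the `(n,K′)`-fibre of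
`V`, then `minAction_{K,K′}(D_{K,K′}U′) = A(U′)` (`≤`: `U′` lies in the one-step fibre of its own average; `≥`: every element of that one-step fibre lies in the
`(n,K′)`-fibre of `V`, `mem_fibre_trans` ∘ `descendTo_mem_fibre`). [cite: Balaban1985UV3, (41)-(42) p.266; Balaban1987RG1, (0.11) p.253] -/
theorem minAction_descendTo_eq_of_isMinOn {n K K' : ℕ} (h₁ : n ≤ K) (h₂ : K ≤ K') {V : GaugeField (F.P n) 0 G} {U' : GaugeField (F.P K') 0 G}
    (hU' : U' ∈ fibre F ℰ n K' (h₁.trans h₂) V) (hmin : IsMinOn (fun U => wilsonAction4 U) (fibre F ℰ n K' (h₁.trans h₂) V) U') :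
    minAction F ℰ K K' h₂ (descendTo F ℰ K K' h₂ U') = wilsonAction4 U' := by
  refine le_antisymm (minAction_descendTo_le F ℰ U') ?_
  unfold minAction
  refine le_csInf ⟨_, U', (mem_fibre_iff F ℰ).mpr rfl, rfl⟩ ?_
  rintro _ ⟨U'', hU'', rfl⟩
  exact hmin (mem_fibre_trans F ℰ h₁ h₂ hU'' (descendTo_mem_fibre F ℰ h₁ h₂ hU'))

/-- **ARGMIN COMPOSITION AT THE TREE'S FIBRES, OVER THE IMAGE**: if `U′` minimises the Wilson action over the `(n,K′)`-fibre of `V`, then its `(K′−K)`-fold average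
`D_{K,K′}U′` minimises the one-step classical effective action `W ↦ minAction_{K,K′}(W)` over the averages of that fibre (no surjectivity needed).
[cite: Balaban1985UV3, (41)-(42) p.266; Balaban1987RG1, (0.11) p.253] -/
theorem isMinOn_minAction_descendTo_image_of_isMinOn {n K K' : ℕ} (h₁ : n ≤ K) (h₂ : K ≤ K') {V : GaugeField (F.P n) 0 G} {U' : GaugeField (F.P K') 0 G}
    (hU' : U' ∈ fibre F ℰ n K' (h₁.trans h₂) V) (hmin : IsMinOn (fun U => wilsonAction4 U) (fibre F ℰ n K' (h₁.trans h₂) V) U') :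
    IsMinOn (fun W => minAction F ℰ K K' h₂ W) (descendTo F ℰ K K' h₂ '' fibre F ℰ n K' (h₁.trans h₂) V) (descendTo F ℰ K K' h₂ U') := by
  intro W hW
  obtain ⟨U'', hU'', rfl⟩ := hW
  show minAction F ℰ K K' h₂ (descendTo F ℰ K K' h₂ U') ≤ minAction F ℰ K K' h₂ (descendTo F ℰ K K' h₂ U'')
  rw [minAction_descendTo_eq_of_isMinOn F ℰ h₁ h₂ hU' hmin]
  unfold minAction
  refine le_csInf ⟨_, U'', (mem_fibre_iff F ℰ).mpr rfl, rfl⟩ ?_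
  rintro _ ⟨U₃, hU₃, rfl⟩
  exact hmin (mem_fibre_trans F ℰ h₁ h₂ hU₃ (descendTo_mem_fibre F ℰ h₁ h₂ hU''))

/-- ★ **ARGMIN COMPOSITION AT THE TREE'S FIBRES**: under the surjectivity of the one-step averaging `D_{K,K′}` (hypothesis `hne`, as in `T3DescentFibreTower.minAction_tower`),
if `U′` minimises the Wilson action over the `(n,K′)`-fibre of `V` then `D_{K,K′}U′` lies in the `(n,K)`-fibre of `V` AND MINIMISES THE ONE-STEP CLASSICAL EFFECTIVE ACTION
`W ↦ minAction_{K,K′}(W)` OVER IT — run `K`'s constrained minimiser and the averaged run-`K′` constrained minimiser are the minimisers, over ONE fibre, of `A_K` and of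
`A¹ := minAction_{K,K′}`. [cite: Balaban1985UV3, (41)-(42) p.266; Balaban1987RG1, (0.11) p.253] -/
theorem isMinOn_minAction_descendTo_of_isMinOn {n K K' : ℕ} (h₁ : n ≤ K) (h₂ : K ≤ K')
    (hne : ∀ W : GaugeField (F.P K) 0 G, (fibre F ℰ K K' h₂ W).Nonempty) {V : GaugeField (F.P n) 0 G} {U' : GaugeField (F.P K') 0 G}
    (hU' : U' ∈ fibre F ℰ n K' (h₁.trans h₂) V) (hmin : IsMinOn (fun U => wilsonAction4 U) (fibre F ℰ n K' (h₁.trans h₂) V) U') :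
    descendTo F ℰ K K' h₂ U' ∈ fibre F ℰ n K h₁ V ∧
      IsMinOn (fun W => minAction F ℰ K K' h₂ W) (fibre F ℰ n K h₁ V) (descendTo F ℰ K K' h₂ U') := by
  refine ⟨descendTo_mem_fibre F ℰ h₁ h₂ hU', fun W hW => ?_⟩
  obtain ⟨U'', hU''⟩ := hne W
  show minAction F ℰ K K' h₂ (descendTo F ℰ K K' h₂ U') ≤ minAction F ℰ K K' h₂ W
  rw [minAction_descendTo_eq_of_isMinOn F ℰ h₁ h₂ hU' hmin]
  unfold minAction
  refine le_csInf ⟨_, U'', hU'', rfl⟩ ?_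
  rintro _ ⟨U₃, hU₃, rfl⟩
  exact hmin (mem_fibre_trans F ℰ h₁ h₂ hU₃ hW)

/-- ★ **AT THE PRINTED SMEARING, HYPOTHESIS-FREE** (`G = SU(2)`, `ℰ = ℰp`: every fibre is nonempty, `T3DescentSection.fibre_nonempty_ℰp`): the `(K′−K)`-fold average of a
constrained minimiser of run `K′` over the fibre of `V` is a constrained minimiser, over run `K`'s fibre of `V`, of the one-step classical effective action
`W ↦ minAction_{K,K′}(W)` — the form the I-11 row uses (`K′ = K + 1`). [cite: Balaban1985UV3, (41)-(42) p.266; Balaban1987RG1, (0.11) p.253] -/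
theorem isMinOn_minAction_descendTo_of_isMinOn_ℰp (F : T3Family) {n K K' : ℕ} (h₁ : n ≤ K) (h₂ : K ≤ K')
    {V : GaugeField (F.P n) 0 (Matrix.specialUnitaryGroup (Fin 2) ℂ)} {U' : GaugeField (F.P K') 0 (Matrix.specialUnitaryGroup (Fin 2) ℂ)}
    (hU' : U' ∈ fibre F ℰp n K' (h₁.trans h₂) V) (hmin : IsMinOn (fun U => wilsonAction4 U) (fibre F ℰp n K' (h₁.trans h₂) V) U') :
    descendTo F ℰp K K' h₂ U' ∈ fibre F ℰp n K h₁ V ∧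
      IsMinOn (fun W => minAction F ℰp K K' h₂ W) (fibre F ℰp n K h₁ V) (descendTo F ℰp K K' h₂ U') ∧
        minAction F ℰp K K' h₂ (descendTo F ℰp K K' h₂ U') = wilsonAction4 U' :=
  ⟨(isMinOn_minAction_descendTo_of_isMinOn F ℰp h₁ h₂ (fibre_nonempty_ℰp F h₂) hU' hmin).1,
    (isMinOn_minAction_descendTo_of_isMinOn F ℰp h₁ h₂ (fibre_nonempty_ℰp F h₂) hU' hmin).2,
    minAction_descendTo_eq_of_isMinOn F ℰp h₁ h₂ hU' hmin⟩

/-- **THE NESTED VALUES AGREE ALONG MINIMISERS**: `minAction_{n,K′}(V) = A(U′) = minAction_{K,K′}(D_{K,K′}U′)` for a minimiser `U′` over the `(n,K′)`-fibre (the value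
identity behind `minAction_tower`, read at the argmin). [cite: Balaban1985UV3, (41)-(42) p.266] -/
theorem minAction_eq_minAction_descendTo_of_isMinOn {n K K' : ℕ} (h₁ : n ≤ K) (h₂ : K ≤ K') {V : GaugeField (F.P n) 0 G} {U' : GaugeField (F.P K') 0 G}
    (hU' : U' ∈ fibre F ℰ n K' (h₁.trans h₂) V) (hmin : IsMinOn (fun U => wilsonAction4 U) (fibre F ℰ n K' (h₁.trans h₂) V) U') :
    minAction F ℰ n K' (h₁.trans h₂) V = minAction F ℰ K K' h₂ (descendTo F ℰ K K' h₂ U') := by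
  rw [minAction_eq_of_isMinOn F ℰ (h₁.trans h₂) hU' hmin, minAction_descendTo_eq_of_isMinOn F ℰ h₁ h₂ hU' hmin]

/-- **THE SAME OVER PRINT'S REGULAR FIBRE** `regFibrePr` ([Balaban1985Variational] (2)+(3) = the space (6) ∩ 𝔅_k(V)): if `U′` minimises the Wilson action over the regular
`(n,K′)`-fibre of `V` (radius `ε₀`), then `D_{K,K′}U′` minimises, over the averages of that regular fibre, the one-step functional «infimum of the action over the REGULAR
run-`K′` configurations averaging to `W`» — the generic lemma verbatim; the regularity window of the one-step functional is run `K′`'s, as in print's induction on `k`.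
[cite: Balaban1985Variational, (2)-(3) p.278, (6) p.278, Thm 1 (8) p.279] -/
theorem isMinOn_fibreInf_descendTo_regFibrePr {n K K' : ℕ} (h₁ : n ≤ K) (h₂ : K ≤ K') {ε₀ : ℝ}
    {V : GaugeField (F.P n) 0 (Matrix.specialUnitaryGroup (Fin 2) ℂ)} {U' : GaugeField (F.P K') 0 (Matrix.specialUnitaryGroup (Fin 2) ℂ)}
    (hU' : U' ∈ regFibrePr F n K' (h₁.trans h₂) ε₀ V) (hmin : IsMinOn (fun U => wilsonAction4 U) (regFibrePr F n K' (h₁.trans h₂) ε₀ V) U') :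
    IsMinOn (fun W => sInf ((fun U => wilsonAction4 U) '' (regFibrePr F n K' (h₁.trans h₂) ε₀ V ∩ descendTo F ℰp K K' h₂ ⁻¹' {W})))
        (descendTo F ℰp K K' h₂ '' regFibrePr F n K' (h₁.trans h₂) ε₀ V) (descendTo F ℰp K K' h₂ U') ∧
      sInf ((fun U => wilsonAction4 U) '' (regFibrePr F n K' (h₁.trans h₂) ε₀ V ∩ descendTo F ℰp K K' h₂ ⁻¹' {descendTo F ℰp K K' h₂ U'})) = wilsonAction4 U' := by
  have hbdd : BddBelow ((fun U => wilsonAction4 U) '' regFibrePr F n K' (h₁.trans h₂) ε₀ V) :=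
    ⟨0, by rintro _ ⟨U, _, rfl⟩; exact wilsonAction4_nonneg U⟩
  exact ⟨isMinOn_fibreInf_image_of_isMinOn _ _ _ hU' hmin hbdd, fibreInf_apply_eq_of_isMinOn _ _ _ hU' hmin hbdd⟩

end T3

/-! ## §2 Perturbed constrained critical points in a real inner-product space -/

section Perturbed

variable {E : Type*} [NormedAddCommGroup E] [InnerProductSpace ℝ E]

/-- ★ **THE CORE INEQUALITY**: if `w` is critical along `w − u` (`⟪a, w − u⟫ = 0`, `a = ∇f̃(w)`), the gradient is `m`-strongly monotone between the pair
(`m‖w − u‖² ≤ ⟪a − b, w − u⟫`, `b = ∇f̃(u)`) and `u` is `Λ`-almost critical along `w − u` (`|⟪b, w − u⟫| ≤ Λ‖w − u‖`), then `m‖w − u‖² ≤ Λ‖w − u‖`. [folklore] -/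
theorem mul_norm_sq_le_of_inner {u w a b : E} {m Λ : ℝ} (hcrit : ⟪a, w - u⟫ = 0) (hmono : m * ‖w - u‖ ^ 2 ≤ ⟪a - b, w - u⟫)
    (hgrad : |⟪b, w - u⟫| ≤ Λ * ‖w - u‖) : m * ‖w - u‖ ^ 2 ≤ Λ * ‖w - u‖ := by
  rw [inner_sub_left, hcrit, zero_sub] at hmono
  exact hmono.trans ((neg_le_abs _).trans hgrad)

/-- ★ **PERTURBED CONSTRAINED CRITICAL POINTS**: under the hypotheses of `mul_norm_sq_le_of_inner` with `m > 0`, `Λ ≥ 0`: `‖w − u‖ ≤ Λ/m`. [folklore] -/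
theorem norm_sub_le_div_of_inner {u w a b : E} {m Λ : ℝ} (hm : 0 < m) (hΛ : 0 ≤ Λ) (hcrit : ⟪a, w - u⟫ = 0)
    (hmono : m * ‖w - u‖ ^ 2 ≤ ⟪a - b, w - u⟫) (hgrad : |⟪b, w - u⟫| ≤ Λ * ‖w - u‖) : ‖w - u‖ ≤ Λ / m := by
  have h := mul_norm_sq_le_of_inner hcrit hmono hgrad
  rw [le_div_iff₀ hm]
  rcases (norm_nonneg (w - u)).eq_or_lt with h0 | hpos
  · rw [← h0]; simpa using hΛ
  · nlinarith

/-- **SLICE FORM**: `N` a submodule of admissible directions with `w − u ∈ N`; `w` critical on the slice (`⟪a, h⟫ = 0` for `h ∈ N`), strong monotonicity between the pair,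
and `u` a `Λ`-approximate critical point on the slice (`|⟪b, h⟫| ≤ Λ‖h‖` for `h ∈ N`) ⟹ `‖w − u‖ ≤ Λ/m`. [folklore] -/
theorem norm_sub_le_div_of_slice (N : Submodule ℝ E) {u w a b : E} {m Λ : ℝ} (hm : 0 < m) (hΛ : 0 ≤ Λ) (hN : w - u ∈ N)
    (hcrit : ∀ h ∈ N, ⟪a, h⟫ = 0) (hmono : m * ‖w - u‖ ^ 2 ≤ ⟪a - b, w - u⟫) (hgrad : ∀ h ∈ N, |⟪b, h⟫| ≤ Λ * ‖h‖) :
    ‖w - u‖ ≤ Λ / m :=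
  norm_sub_le_div_of_inner hm hΛ (hcrit _ hN) hmono (hgrad _ hN)

/-- **DEFECT FORM** (two functionals): `w` critical for `f̃` on the slice (`a = ∇f̃(w)`), `u` critical for `g̃` on the slice (`c = ∇g̃(u)`), `∇f̃` strongly monotone between
the pair (`b = ∇f̃(u)`), and the DEFECT of the gradients at `u` small on the slice, `|⟪b − c, h⟫| ≤ Λ‖h‖` — then `‖w − u‖ ≤ Λ/m`: minimisers of two functionals over one
constraint slice are as close as the first variation of their difference at either of them, divided by the convexity constant. [cite: King1986, Prop. 3.9 (3.73)-(3.74) p.665] -/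
theorem norm_sub_le_div_of_defect (N : Submodule ℝ E) {u w a b c : E} {m Λ : ℝ} (hm : 0 < m) (hΛ : 0 ≤ Λ) (hN : w - u ∈ N)
    (hcritf : ∀ h ∈ N, ⟪a, h⟫ = 0) (hcritg : ∀ h ∈ N, ⟪c, h⟫ = 0) (hmono : m * ‖w - u‖ ^ 2 ≤ ⟪a - b, w - u⟫)
    (hdef : ∀ h ∈ N, |⟪b - c, h⟫| ≤ Λ * ‖h‖) : ‖w - u‖ ≤ Λ / m := by
  refine norm_sub_le_div_of_slice N hm hΛ hN hcritf hmono fun h hh => ?_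
  have := hdef h hh
  rwa [inner_sub_left, hcritg h hh, sub_zero] at this

/-- **UNIQUENESS** (`Λ = 0`): two points of one slice that are both critical on it for a functional whose gradient is strongly monotone between them COINCIDE — the
variational pin determines the configuration (modulo the slice = gauge fixing), independently of any choice of witness. [cite: Balaban1985Variational, Thm 1 p.279] -/
theorem eq_of_slice_critical (N : Submodule ℝ E) {u w a b : E} {m : ℝ} (hm : 0 < m) (hN : w - u ∈ N)
    (hcritw : ∀ h ∈ N, ⟪a, h⟫ = 0) (hcritu : ∀ h ∈ N, ⟪b, h⟫ = 0) (hmono : m * ‖w - u‖ ^ 2 ≤ ⟪a - b, w - u⟫) : w = u := by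
  have h := norm_sub_le_div_of_slice N hm le_rfl hN hcritw hmono fun h hh => by rw [hcritu h hh, abs_zero, zero_mul]
  rw [zero_div] at h
  exact sub_eq_zero.mp (norm_le_zero_iff.mp h)

variable [CompleteSpace E]

/-- **FERMAT ALONG A LINE**: if `f` has gradient `a` at `w` and `t ↦ f (w + t•h)` has a local minimum at `t = 0`, then `⟪a, h⟫ = 0` (chain rule + Mathlib's
`IsLocalMin.hasDerivAt_eq_zero`). [folklore] -/
theorem inner_gradient_eq_zero_of_isLocalMin_line {f : E → ℝ} {w a : E} (h : E) (hf : HasGradientAt f a w)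
    (hmin : IsLocalMin (fun t : ℝ => f (w + t • h)) 0) : ⟪a, h⟫ = 0 := by
  have hline : HasDerivAt (fun t : ℝ => w + t • h) h 0 := by
    simpa using ((hasDerivAt_id (0 : ℝ)).smul_const h).const_add w
  have hcomp : HasDerivAt (fun t : ℝ => f (w + t • h)) (toDual ℝ E a h) 0 :=
    HasFDerivAt.comp_hasDerivAt_of_eq (x := (0 : ℝ)) hf.hasFDerivAt hline (by simp)
  have := hmin.hasDerivAt_eq_zero hcomp
  rwa [toDual_apply_apply] at this

/-- **FERMAT ON A SLICE FROM A CONSTRAINED MINIMUM**: if `w ∈ S` minimises `f` on `S`, `f` has gradient `a` at `w`, and the line `t ↦ w + t•h` stays in `S` for small `|t|`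
(the direction `h` is admissible: `S` is a neighbourhood of `w` inside the slice — e.g. a minimiser in the OPEN regularity class, `Prop8Criticality.exists_ball_subset_regPr`),
then `⟪a, h⟫ = 0`. [cite: Balaban1985Variational, (158) p.302] -/
theorem inner_gradient_eq_zero_of_isMinOn {f : E → ℝ} {S : Set E} {w a : E} (h : E) (hf : HasGradientAt f a w) (hmin : IsMinOn f S w)
    (hS : ∀ᶠ t : ℝ in 𝓝 0, w + t • h ∈ S) : ⟪a, h⟫ = 0 := by
  refine inner_gradient_eq_zero_of_isLocalMin_line h hf ?_
  show ∀ᶠ t : ℝ in 𝓝 0, f (w + (0 : ℝ) • h) ≤ f (w + t • h)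
  simpa using hS.mono fun t ht => hmin ht

/-- **ALL ADMISSIBLE DIRECTIONS AT ONCE**: under the hypotheses of `inner_gradient_eq_zero_of_isMinOn` for every direction of a submodule `N`, the gradient is orthogonal to
`N` — the input (Crit) of `norm_sub_le_div_of_slice`. [cite: Balaban1985Variational, (158) p.302] -/
theorem inner_gradient_eq_zero_of_isMinOn_slice {f : E → ℝ} {S : Set E} {w a : E} (N : Submodule ℝ E) (hf : HasGradientAt f a w) (hmin : IsMinOn f S w)
    (hS : ∀ h ∈ N, ∀ᶠ t : ℝ in 𝓝 0, w + t • h ∈ S) : ∀ h ∈ N, ⟪a, h⟫ = 0 :=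
  fun h hh => inner_gradient_eq_zero_of_isMinOn h hf hmin (hS h hh)

end Perturbed

/-! ## §2′ The metric variant (quadratic growth), recorded with its caveat -/

section Metric

variable {X : Type*}

/-- **QUADRATIC GROWTH + LIPSCHITZ DEFECT** (derivative-free form): `u` minimises `g` on `S` with quadratic growth `g(x) ≥ g(u) + m·d(x,u)²`, `w` minimises `f` on `S`, and
the defect `f − g` changes by at most `λ·d(w,u)` between `u` and `w` ⟹ `d(w,u) ≤ λ/m`.  CAVEAT (located): for two lattice quadratic forms the honest `λ` along the
slice is `‖(Δ¹−Δ)u‖ + O(‖Δ¹−Δ‖_{op})·d`, whose second part is NOT small against a Poincaré-size `m`; the first-variation form `norm_sub_le_div_of_inner` is the usable one.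
[folklore] -/
theorem le_div_of_quadraticGrowth {S : Set X} (d : X → X → ℝ) (f g : X → ℝ) {u w : X} {m lam : ℝ} (hm : 0 < m) (hlam : 0 ≤ lam)
    (hw : w ∈ S) (hd : 0 ≤ d w u) (hgrow : ∀ x ∈ S, g u + m * d x u ^ 2 ≤ g x) (hmin : ∀ x ∈ S, f w ≤ f x) (hu : u ∈ S)
    (hdef : (f u - g u) - (f w - g w) ≤ lam * d w u) : d w u ≤ lam / m := by
  have h1 : m * d w u ^ 2 ≤ lam * d w u := by
    have := hgrow w hw
    have := hmin u hu
    nlinarith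
  rw [le_div_iff₀ hm]
  rcases hd.eq_or_lt with h0 | hpos
  · rw [← h0]; simpa using hlam
  · nlinarith

end Metric

/-! ## §3 The I-11 row from the variational displays -/

section Row

variable {𝕍 : Type} [NormedAddCommGroup 𝕍] [NormedSpace ℂ 𝕍] {F : T3Family} {γ : ℝ}

omit [NormedSpace ℂ 𝕍] in
/-- ★ **THE I-11 ROW `CfgDistCauchyΦ` FROM THE VARIATIONAL DISPLAYS.**  As `cfgDistCauchyΦ_of_fineComparison` — free `S K` (run `K`'s fine configurations), `U K k W` (run
`K`'s constrained minimiser at current field `W`), `Ubar K k k′ W′` (the once-averaged run-`(K+1)` constrained minimiser, read on run `K`'s fine lattice), `Φ` (the chart-level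
loop-variable maps), (B)/(B′) the structure of `B`, (Lip) the legwise Lipschitz bound — with the comparison functional `δ := ‖coord · − coord ·‖` for a free chart
`coord K k : S K → E K k` into real inner-product spaces, and (Fine) REPLACED by: for every window datum there are vectors `ga` (`= ∇f̃(w)`), `gb` (`= ∇f̃(u)`), at
`u := coord (U_K)`, `w := coord (Ū_{K+1})`, and constants `m > 0`, `Λ` with (Crit) `⟪ga, w − u⟫ = 0` — `Ū_{K+1}` is critical for the one-step effective action `f̃ = A¹_{K+1}∘chart`
along `w − u` (§1 + `inner_gradient_eq_zero_of_isMinOn`); (Mono) `m‖w − u‖² ≤ ⟪ga − gb, w − u⟫` — strong monotonicity of `∇f̃` between the pair; (Grad) `|⟪gb, w − u⟫| ≤ Λ‖w − u‖` —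
run `K`'s minimiser is a `Λ`-APPROXIMATE CRITICAL POINT of `f̃` along `w − u`; (Rate) `Λ ≤ m·C_f·θ(n)·(L^{−(K−n)})^a`.  Then `CfgDistCauchyΦ D B dist b₀ p₀ a (L_Φ·C_f)`.
(Grad)+(Rate) is the ONE analytic input, a single-lattice one-block-spin-step statement; located-UNPRINTED for the non-abelian d = 3 model.
[cite: King1986, Prop. 3.8 (3.71) p.664, Prop. 3.9 (3.73)-(3.74) p.665; Balaban1985Variational, (50)-(54) pp.285-286; Balaban1985UV3, (41)-(44) pp.266-267] -/
theorem cfgDistCauchyΦ_of_variational {D : AlphaDataT3 F γ} {B : CfgFam 𝕍 F} {dist : LegDist F} {b₀ p₀ a L_Φ C_f : ℝ} (S : ℕ → Type)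
    (E : ℕ → ℕ → Type) [∀ K k, NormedAddCommGroup (E K k)] [∀ K k, InnerProductSpace ℝ (E K k)] (coord : (K k : ℕ) → S K → E K k)
    (U : (K k : ℕ) → GaugeField (F.P K) k (Matrix.specialUnitaryGroup (Fin 2) ℂ) → S K)
    (Ubar : (K k k' : ℕ) → GaugeField (F.P (K + 1)) k' (Matrix.specialUnitaryGroup (Fin 2) ℂ) → S K)
    (Φ : (K k b : ℕ) → Set (Site (F.P K) 0) → S K → (PBond (F.P K) b → 𝕍))
    (hn : DistNonneg dist) (hL : 1 ≤ F.L) (hγ : 0 < γ) (hγ1 : γ ≤ 1) (hb : 0 < b₀) (hLΦ : 0 ≤ L_Φ) (hCf : 0 ≤ C_f) (ha : 0 ≤ a)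
    (hB : ∀ (K n : ℕ) (h : n ≤ K), ∀ j : ℕ, j < K - n →
      ∀ V : GaugeField (F.P n) 0 (Matrix.specialUnitaryGroup (Fin 2) ℂ), PlaqSmall (θBal F.L γ b₀ p₀ n) V →
        ∀ Y ∈ D.Loc K (K - n) (D.triv K (K - n)) (1 + j),
          B K (K - n) j Y (fieldShift (F.sitesPerDir_eq (m := F.m) (K := K) (j := K - n) (m' := F.m) (K' := n) (j' := 0) (by omega)) V) = Φ K (K - n) j Y (U K (K - n) (fieldShift (F.sitesPerDir_eq (m := F.m) (K := K) (j := K - n) (m' := F.m) (K' := n) (j' := 0) (by omega)) V)))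
    (hB' : ∀ (K n : ℕ) (h : n ≤ K), ∀ j : ℕ, j < K - n →
      ∀ V : GaugeField (F.P n) 0 (Matrix.specialUnitaryGroup (Fin 2) ℂ), PlaqSmall (θBal F.L γ b₀ p₀ n) V →
        ∀ Y ∈ D.Loc K (K - n) (D.triv K (K - n)) (1 + j), ∀ c : PBond (F.P K) j,
          B (K + 1) (K + 1 - n) (j + 1) (refineSet F K Y) (fieldShift (F.sitesPerDir_eq (m := F.m) (K := K + 1) (j := K + 1 - n) (m' := F.m) (K' := n) (j' := 0) (by omega)) V) (matchBond F K j c) =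
            Φ K (K - n) j Y (Ubar K (K - n) (K + 1 - n) (fieldShift (F.sitesPerDir_eq (m := F.m) (K := K + 1) (j := K + 1 - n) (m' := F.m) (K' := n) (j' := 0) (by omega)) V)) c)
    (hLip : ∀ (K n : ℕ) (h : n ≤ K), ∀ j : ℕ, j < K - n →
      ∀ V : GaugeField (F.P n) 0 (Matrix.specialUnitaryGroup (Fin 2) ℂ), PlaqSmall (θBal F.L γ b₀ p₀ n) V →
        ∀ Y ∈ D.Loc K (K - n) (D.triv K (K - n)) (1 + j), ∀ c : PBond (F.P K) j,
          ‖Φ K (K - n) j Y (U K (K - n) (fieldShift (F.sitesPerDir_eq (m := F.m) (K := K) (j := K - n) (m' := F.m) (K' := n) (j' := 0) (by omega)) V)) c - Φ K (K - n) j Y (Ubar K (K - n) (K + 1 - n) (fieldShift (F.sitesPerDir_eq (m := F.m) (K := K + 1) (j := K + 1 - n) (m' := F.m) (K' := n) (j' := 0) (by omega)) V)) c‖ ≤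
            L_Φ * (1 + dist K j Y c) * (((F.L : ℝ) ^ (K - n - 1 - j))⁻¹) ^ 2 *
              ‖coord K (K - n) (U K (K - n) (fieldShift (F.sitesPerDir_eq (m := F.m) (K := K) (j := K - n) (m' := F.m) (K' := n) (j' := 0) (by omega)) V)) -
                coord K (K - n) (Ubar K (K - n) (K + 1 - n) (fieldShift (F.sitesPerDir_eq (m := F.m) (K := K + 1) (j := K + 1 - n) (m' := F.m) (K' := n) (j' := 0) (by omega)) V))‖)
    (hVar : ∀ (K n : ℕ) (h : n ≤ K), 0 < K - n → ∀ V : GaugeField (F.P n) 0 (Matrix.specialUnitaryGroup (Fin 2) ℂ), PlaqSmall (θBal F.L γ b₀ p₀ n) V →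
      ∃ (ga gb : E K (K - n)) (m Λ : ℝ), 0 < m ∧
        ⟪ga, coord K (K - n) (Ubar K (K - n) (K + 1 - n) (fieldShift (F.sitesPerDir_eq (m := F.m) (K := K + 1) (j := K + 1 - n) (m' := F.m) (K' := n) (j' := 0) (by omega)) V)) -
              coord K (K - n) (U K (K - n) (fieldShift (F.sitesPerDir_eq (m := F.m) (K := K) (j := K - n) (m' := F.m) (K' := n) (j' := 0) (by omega)) V))⟫ = 0 ∧
        m * ‖coord K (K - n) (Ubar K (K - n) (K + 1 - n) (fieldShift (F.sitesPerDir_eq (m := F.m) (K := K + 1) (j := K + 1 - n) (m' := F.m) (K' := n) (j' := 0) (by omega)) V)) -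
              coord K (K - n) (U K (K - n) (fieldShift (F.sitesPerDir_eq (m := F.m) (K := K) (j := K - n) (m' := F.m) (K' := n) (j' := 0) (by omega)) V))‖ ^ 2 ≤
          ⟪ga - gb, coord K (K - n) (Ubar K (K - n) (K + 1 - n) (fieldShift (F.sitesPerDir_eq (m := F.m) (K := K + 1) (j := K + 1 - n) (m' := F.m) (K' := n) (j' := 0) (by omega)) V)) -
              coord K (K - n) (U K (K - n) (fieldShift (F.sitesPerDir_eq (m := F.m) (K := K) (j := K - n) (m' := F.m) (K' := n) (j' := 0) (by omega)) V))⟫ ∧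
        |⟪gb, coord K (K - n) (Ubar K (K - n) (K + 1 - n) (fieldShift (F.sitesPerDir_eq (m := F.m) (K := K + 1) (j := K + 1 - n) (m' := F.m) (K' := n) (j' := 0) (by omega)) V)) -
              coord K (K - n) (U K (K - n) (fieldShift (F.sitesPerDir_eq (m := F.m) (K := K) (j := K - n) (m' := F.m) (K' := n) (j' := 0) (by omega)) V))⟫| ≤
          Λ * ‖coord K (K - n) (Ubar K (K - n) (K + 1 - n) (fieldShift (F.sitesPerDir_eq (m := F.m) (K := K + 1) (j := K + 1 - n) (m' := F.m) (K' := n) (j' := 0) (by omega)) V)) -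
              coord K (K - n) (U K (K - n) (fieldShift (F.sitesPerDir_eq (m := F.m) (K := K) (j := K - n) (m' := F.m) (K' := n) (j' := 0) (by omega)) V))‖ ∧
        Λ ≤ m * (C_f * θBal F.L γ b₀ p₀ n * (((F.L : ℝ) ^ (K - n))⁻¹) ^ a)) :
    CfgDistCauchyΦ D B dist b₀ p₀ a (L_Φ * C_f) := by
  refine cfgDistCauchyΦ_of_fineComparison S U Ubar Φ (fun K k s s' => ‖coord K k s - coord K k s'‖) hn hL hγ hγ1 hb hLΦ hCf ha hB hB' hLip ?_
  intro K n hnK hk V hV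
  obtain ⟨ga, gb, m, Λ, hm, hcrit, hmono, hgrad, hrate⟩ := hVar K n hnK hk V hV
  have hθ : 0 ≤ θBal F.L γ b₀ p₀ n := (T3MinimiserStabilityReduction.θBal_pos hL hγ hγ1 hb p₀ n).le
  have hLr : (0 : ℝ) ≤ F.L := by positivity
  have hbud : 0 ≤ C_f * θBal F.L γ b₀ p₀ n * (((F.L : ℝ) ^ (K - n))⁻¹) ^ a := by positivity
  have hsq := mul_norm_sq_le_of_inner hcrit hmono hgrad
  rw [norm_sub_rev]
  set δ := ‖coord K (K - n) (Ubar K (K - n) (K + 1 - n) (fieldShift (F.sitesPerDir_eq (m := F.m) (K := K + 1) (j := K + 1 - n) (m' := F.m) (K' := n) (j' := 0) (by omega)) V)) -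
      coord K (K - n) (U K (K - n) (fieldShift (F.sitesPerDir_eq (m := F.m) (K := K) (j := K - n) (m' := F.m) (K' := n) (j' := 0) (by omega)) V))‖ with hδ
  have hδ0 : 0 ≤ δ := norm_nonneg _
  rcases hδ0.eq_or_lt with h0 | hpos
  · rw [← h0]; exact hbud
  · have h1 : m * δ ≤ Λ := by nlinarith
    have h2 : m * δ ≤ m * (C_f * θBal F.L γ b₀ p₀ n * (((F.L : ℝ) ^ (K - n))⁻¹) ^ a) := h1.trans hrate
    exact le_of_mul_le_mul_left h2 hm

end Row

end Summit.QuantumFields.YangMills.Theorems.GlobalSlackKernelLeg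

end
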